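import Summits.QuantumAdvantage.QuantumAdvantage.Theses.SymplecticPurity
import Literature.Computability.QuantumComplexity.RandomizedQuerySimulation

/-!
# `CompositeFrameBound` (stmt-QuantumAdvantage-10730) — I: vocabulary and LOAD-BEARING analysis

Support / negative lemmas for the crux `SymplecticPurity.CompositeFrameBound` (depth-3
Clifford∘Gaussian∘Clifford frames keep a cut of the cube graph state `ĝ` at purity `≤ 2^{-cn}`),
extracted from the refuter work file
`Summits/QuantumAdvantage/QuantumAdvantage/Cruxes/CompositeFrameBound/Disproof.lean` (generation 2,
refuter-cdisprove-stmt-QuantumAdvantage-10730-g2-0) so that provers, planners and ideators can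
IMPORT them (the work file is overwritten by every generation).  Sorry-free.

* §0 vocabulary: `ghat` (LITERALLY the crux's vector), `cutPurity` (its 4-fold agreement sum),
  `IsCliffordU`, `IsGaussianU`, the schema `FrameBound` (so the three
  weakenings of §1 are `FrameBound` with one predicate replaced by `True`), and
  `crux_iff : CompositeFrameBound ↔ FrameBound Clifford Clifford Gaussian` (by `Iff.rfl`).
* §2 toolkit: `‖ĝ‖² = 1`, basis states have purity `1` at every cut, a field of order `2ⁿ` with an
  additive identification exists (`GaloisField`), identity frames, a unitary sending `ĝ` to `|0…0⟩`.
* §1 LOAD-BEARING: `false_without_clifford₁`, `false_without_clifford₂`, `false_without_gaussian` —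
  drop the STRUCTURE predicate of any one layer (keep its unitarity) and the statement is false:
  that layer may be a full disentangler.  Any proof of the crux uses all three structures.

Sequels: `SpectralMass.lean` (purity = Pauli spectral mass; Clifford relabelling),
`SparsePeaks.lean` (the U₂-free reduction).
-/

noncomputable section

set_option linter.dupNamespace false

namespace Summit.QuantumAdvantage.QuantumAdvantage.Theorems.CompositeFrameBound.Negative

open Literature.Computability.Cryptography Literature.Computability.QuantumComplexity Matrix
open Summit.QuantumAdvantage.QuantumAdvantage.Theses.SymplecticPurity (CompositeFrameBound)

/-! ## §0 Vocabulary and the crux restated through it -/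

/-- The normalised cube graph state `ĝ = 2^{-n/2} Σ_x |x⟩|x³⟩` on `n + n` wires, LITERALLY the
vector appearing in the crux (data wires `Fin.castAdd n i`, value wires `Fin.natAdd n j`). [folklore] -/
def ghat (n : ℕ) (K : Type) [Field K] [Fintype K] (e : K ≃+ (Fin n → ZMod 2)) :
    QReg (n + n) → ℂ :=
  fun w : QReg (n + n) => if (fun j : Fin n => w (Fin.natAdd n j)) =
      (fun j : Fin n => decide (e ((e.symm (fun i : Fin n => if w (Fin.castAdd n i) then 1 else 0)) ^ 3) j = 1))
    then ((Real.sqrt 2 ^ n)⁻¹ : ℂ) else 0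

/-- The bits of `x³`, read through the identification `e`. [folklore] -/
def cubeBits (n : ℕ) {K : Type} [Field K] (e : K ≃+ (Fin n → ZMod 2)) (x : QReg n) : QReg n :=
  fun j : Fin n => decide (e ((e.symm (fun i : Fin n => if x i then 1 else 0)) ^ 3) j = 1)

/-- The purity `Tr ρ²_{wires < k}` of the linear cut `{wires < k}` of a state vector `ψ`, written
as the crux writes it: the 4-fold agreement sum. [folklore] -/
def cutPurity {N : ℕ} (ψ : QReg N → ℂ) (k : ℕ) : ℂ :=
  ∑ x₁ : QReg N, ∑ x₂ : QReg N, ∑ x₃ : QReg N, ∑ x₄ : QReg N,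
    (if (∀ i, k ≤ i.val → x₁ i = x₂ i) ∧ (∀ i, i.val < k → x₂ i = x₃ i) ∧
        (∀ i, k ≤ i.val → x₃ i = x₄ i) ∧ (∀ i, i.val < k → x₄ i = x₁ i)
      then ψ x₁ * star (ψ x₂) * ψ x₃ * star (ψ x₄) else 0)

/-- SEMANTIC Clifford unitary (the crux's typing of the outer layers): conjugation maps every
Pauli string to a unit-phase multiple of a Pauli string. (Unitarity is a separate hypothesis.) [folklore] -/
def IsCliffordU {N : ℕ} (U : Matrix (QReg N) (QReg N) ℂ) : Prop :=
  ∀ S : Fin N → Pauli, ∃ S' : Fin N → Pauli, ∃ c : ℂ, ‖c‖ = 1 ∧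
    U * pauliString S * star U = c • pauliString S'

/-- Fermionic GAUSSIAN unitary (the crux's typing of the middle layer): conjugation rotates the
Jordan–Wigner Majoranas by a real orthogonal `R`. [folklore] -/
def IsGaussianU {N : ℕ} (U : Matrix (QReg N) (QReg N) ℂ) : Prop :=
  ∃ R : Matrix (Fin N × Bool) (Fin N × Bool) ℝ, R * Rᵀ = 1 ∧
    ∀ p : Fin N × Bool, U * majorana N p.1 p.2 * star U =
      ∑ q : Fin N × Bool, (R p q : ℂ) • majorana N q.1 q.2

/-- The frame-bound SCHEMA: the crux with the three structure predicates of the layers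
(`P₁` outer-right, `P₂` outer-left, `P` middle) as parameters; unitarity of each layer is kept. [folklore] -/
def FrameBound (P₁ P₂ P : (N : ℕ) → Matrix (QReg N) (QReg N) ℂ → Prop) : Prop :=
  ∃ c : ℝ, 0 < c ∧ ∃ n₀ : ℕ, ∀ n ≥ n₀, ∀ (K : Type) [Field K] [Fintype K], Fintype.card K = 2 ^ n →
    ∀ e : K ≃+ (Fin n → ZMod 2), ∀ U₁ U₂ U : Matrix (QReg (n + n)) (QReg (n + n)) ℂ,
      U₁ ∈ Matrix.unitaryGroup (QReg (n + n)) ℂ → P₁ (n + n) U₁ →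
      U₂ ∈ Matrix.unitaryGroup (QReg (n + n)) ℂ → P₂ (n + n) U₂ →
      U ∈ Matrix.unitaryGroup (QReg (n + n)) ℂ → P (n + n) U →
      ∃ k ≤ n + n, ‖cutPurity (U₂.mulVec (U.mulVec (U₁.mulVec (ghat n K e)))) k‖ ≤
        (2 : ℝ) ^ (-(c * (n : ℝ)))

/-- The crux IS the schema at (Clifford, Clifford, Gaussian) — definitionally. [folklore] -/
theorem crux_iff :
    CompositeFrameBound ↔ FrameBound (fun _ => IsCliffordU) (fun _ => IsCliffordU) (fun _ => IsGaussianU) :=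
  Iff.rfl


/-! ## §2 Toolkit: the cube state, basis states, fields, unitaries -/

/-- Amplitudes of `ĝ` on a split register `w = x ++ y`: `2^{-n/2}·[y = bits(x³)]`. [folklore] -/
theorem ghat_append {n : ℕ} {K : Type} [Field K] [Fintype K] (e : K ≃+ (Fin n → ZMod 2))
    (x y : QReg n) :
    ghat n K e (Fin.append x y) = if y = cubeBits n e x then ((Real.sqrt 2 ^ n)⁻¹ : ℂ) else 0 := by
  simp only [ghat, cubeBits, Fin.append_left, Fin.append_right, funext_iff]

/-- `‖ĝ‖² = 1`: exactly one value string per data string, `2ⁿ` strings of amplitude `2^{-n/2}`. [folklore] -/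
theorem sum_norm_sq_ghat {n : ℕ} {K : Type} [Field K] [Fintype K] (e : K ≃+ (Fin n → ZMod 2)) :
    ∑ w, ‖ghat n K e w‖ ^ 2 = 1 := by
  have h1 : ∑ w, ‖ghat n K e w‖ ^ 2 =
      ∑ p : QReg n × QReg n, ‖ghat n K e (Fin.append p.1 p.2)‖ ^ 2 :=
    (Fintype.sum_equiv (Fin.appendEquiv n n) _ _ (fun _ => rfl)).symm
  have h2 : ∀ p : QReg n × QReg n, ‖ghat n K e (Fin.append p.1 p.2)‖ ^ 2 =
      if p.2 = cubeBits n e p.1 then ((2 : ℝ) ^ n)⁻¹ else 0 := by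
    intro p
    rw [ghat_append]
    split_ifs
    · rw [norm_inv, norm_pow, Complex.norm_real, Real.norm_eq_abs,
        abs_of_nonneg (Real.sqrt_nonneg 2), inv_pow, ← pow_mul, mul_comm n 2, pow_mul,
        Real.sq_sqrt (by norm_num : (0:ℝ) ≤ 2)]
    · simp
  rw [h1, Fintype.sum_congr _ _ h2, Fintype.sum_prod_type]
  simp only [Finset.sum_ite_eq', Finset.mem_univ, if_true, Finset.sum_const, Finset.card_univ,
    Fintype.card_fun, Fintype.card_bool, Fintype.card_fin, nsmul_eq_mul]
  push_cast
  exact mul_inv_cancel₀ (by positivity)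

/-- `ĝ` as a star-dot-product unit vector. [folklore] -/
theorem star_ghat_dotProduct_ghat {n : ℕ} {K : Type} [Field K] [Fintype K]
    (e : K ≃+ (Fin n → ZMod 2)) : star (ghat n K e) ⬝ᵥ ghat n K e = 1 := by
  have h := congrArg ((↑) : ℝ → ℂ) (sum_norm_sq_ghat e)
  push_cast at h
  simpa only [dotProduct, Pi.star_apply, Complex.star_def, Complex.conj_mul'] using h

/-- Purity of every linear cut of a computational basis state is `1`. [folklore] -/
theorem cutPurity_basisState {N : ℕ} (x : QReg N) (k : ℕ) : cutPurity (basisState x) k = 1 := by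
  have key : ∀ x₁ x₂ x₃ x₄ : QReg N,
      (if (∀ i, k ≤ i.val → x₁ i = x₂ i) ∧ (∀ i, i.val < k → x₂ i = x₃ i) ∧
          (∀ i, k ≤ i.val → x₃ i = x₄ i) ∧ (∀ i, i.val < k → x₄ i = x₁ i)
        then basisState x x₁ * star (basisState x x₂) * basisState x x₃ * star (basisState x x₄)
        else 0) =
      if x₄ = x then (if x₃ = x then (if x₂ = x then (if x₁ = x then (1 : ℂ) else 0) else 0)
        else 0) else 0 := by
    intro x₁ x₂ x₃ x₄
    by_cases h1 : x₁ = x <;> by_cases h2 : x₂ = x <;> by_cases h3 : x₃ = x <;>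
      by_cases h4 : x₄ = x <;> simp [basisState_apply, h1, h2, h3, h4]
  simp only [cutPurity, key, Finset.sum_ite_eq', Finset.mem_univ, if_true]

/-- A field of order `2ⁿ` with an additive identification with `𝔽₂ⁿ` exists for every `n ≥ 1`
(`GaloisField 2 n`): the crux's `∀ K ∀ e` is never vacuous. [folklore] -/
theorem exists_field (n : ℕ) (hn : n ≠ 0) :
    ∃ (K : Type) (_ : Field K) (_ : Fintype K),
      Fintype.card K = 2 ^ n ∧ Nonempty (K ≃+ (Fin n → ZMod 2)) := by
  haveI : Fact (Nat.Prime 2) := ⟨Nat.prime_two⟩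
  letI : Fintype (GaloisField 2 n) := Fintype.ofFinite _
  refine ⟨GaloisField 2 n, inferInstance, inferInstance, ?_, ?_⟩
  · rw [← Nat.card_eq_fintype_card]
    exact GaloisField.card 2 n hn
  · exact ⟨(Module.finBasisOfFinrankEq (ZMod 2) (GaloisField 2 n)
      (GaloisField.finrank 2 hn)).equivFun.toAddEquiv⟩

/-- A DISENTANGLING UNITARY for `ĝ`: some unitary maps `ĝ` to the basis state `|0…0⟩`
(all its linear cuts then have purity `1`), from the tree's orthonormal-extension lemma
`RandTreeSim.exists_unitary_mulVec_single_eq`. This is the witness behind all of §1. [folklore] -/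
theorem exists_unitary_ghat_to_zero {n : ℕ} {K : Type} [Field K] [Fintype K]
    (e : K ≃+ (Fin n → ZMod 2)) :
    ∃ V ∈ Matrix.unitaryGroup (QReg (n + n)) ℂ, V *ᵥ ghat n K e = zeroState (n + n) := by
  obtain ⟨U, hU⟩ := Literature.Computability.QuantumComplexity.RandTreeSim.exists_unitary_mulVec_single_eq
    (fun _ : Fin (n + n) => false) (ghat n K e) (sum_norm_sq_ghat e)
  refine ⟨star (U : Matrix (QReg (n + n)) (QReg (n + n)) ℂ), ?_, ?_⟩
  · exact Unitary.star_mem U.prop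
  · rw [← hU, Matrix.mulVec_mulVec, Matrix.UnitaryGroup.star_mul_self, Matrix.one_mulVec]
    rfl

/-- The identity is a (semantic) Clifford unitary. [folklore] -/
theorem isCliffordU_one (N : ℕ) : IsCliffordU (1 : Matrix (QReg N) (QReg N) ℂ) := by
  intro S
  exact ⟨S, 1, by simp, by simp⟩

/-- The identity is a Gaussian unitary (`R = 1`). [folklore] -/
theorem isGaussianU_one (N : ℕ) : IsGaussianU (1 : Matrix (QReg N) (QReg N) ℂ) := by
  refine ⟨1, by simp, fun p => ?_⟩
  simp only [Matrix.one_mul, star_one, Matrix.mul_one, Matrix.one_apply]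
  simp only [apply_ite ((↑) : ℝ → ℂ), Complex.ofReal_one, Complex.ofReal_zero, ite_smul,
    one_smul, zero_smul, Finset.sum_ite_eq, Finset.mem_univ, if_true]

/-! ## §1 Load-bearing analysis: every layer's STRUCTURE hypothesis is necessary

Drop the structure predicate of any one layer (keeping its unitarity) and the statement is
false: that layer can then be a full disentangler of `ĝ`. Hence ANY proof of the crux must use the
Clifford property of `U₁`, the Clifford property of `U₂` AND the Gaussian property of `U`. -/

/-- Master lemma: a schema that admits, for every `n ≥ 1`, field and identification, a frame
inside its three predicates mapping `ĝ` to a computational basis state, is false. [folklore] -/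
theorem not_frameBound_of_disentangler {P₁ P₂ P : (N : ℕ) → Matrix (QReg N) (QReg N) ℂ → Prop}
    (h : ∀ n : ℕ, 1 ≤ n → ∀ (K : Type) [Field K] [Fintype K], Fintype.card K = 2 ^ n →
      ∀ e : K ≃+ (Fin n → ZMod 2), ∃ U₁ U₂ U : Matrix (QReg (n + n)) (QReg (n + n)) ℂ,
        U₁ ∈ Matrix.unitaryGroup (QReg (n + n)) ℂ ∧ P₁ (n + n) U₁ ∧
        U₂ ∈ Matrix.unitaryGroup (QReg (n + n)) ℂ ∧ P₂ (n + n) U₂ ∧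
        U ∈ Matrix.unitaryGroup (QReg (n + n)) ℂ ∧ P (n + n) U ∧
        ∃ x : QReg (n + n), U₂ *ᵥ (U *ᵥ (U₁ *ᵥ ghat n K e)) = basisState x) :
    ¬ FrameBound P₁ P₂ P := by
  rintro ⟨c, hc, n₀, H⟩
  obtain ⟨K, iF, iT, hK, ⟨e⟩⟩ := exists_field (max n₀ 1) (by omega)
  obtain ⟨U₁, U₂, U, h1, p1, h2, p2, h3, p3, x, hx⟩ :=
    h (max n₀ 1) (le_max_right _ _) K hK e
  obtain ⟨k, -, hk⟩ := H (max n₀ 1) (le_max_left _ _) K hK e U₁ U₂ U h1 p1 h2 p2 h3 p3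
  rw [hx, cutPurity_basisState, norm_one] at hk
  have : (2 : ℝ) ^ (-(c * ((max n₀ 1 : ℕ) : ℝ))) < 1 :=
    Real.rpow_lt_one_of_one_lt_of_neg (by norm_num) (by
      have : (1 : ℝ) ≤ ((max n₀ 1 : ℕ) : ℝ) := by exact_mod_cast le_max_right n₀ 1
      nlinarith)
  linarith

/-- ANY PROOF MUST USE that `U₁` is Clifford: the crux with the Clifford hypothesis on `U₁`
dropped (unitarity kept) is false — `U₁` may be a disentangler. [folklore] -/
theorem false_without_clifford₁ :
    ¬ FrameBound (fun _ _ => True) (fun _ => IsCliffordU) (fun _ => IsGaussianU) := by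
  refine not_frameBound_of_disentangler fun n _ K _ _ _ e => ?_
  obtain ⟨V, hV, hVg⟩ := exists_unitary_ghat_to_zero e
  refine ⟨V, 1, 1, hV, trivial, Submonoid.one_mem _, isCliffordU_one _, Submonoid.one_mem _,
    isGaussianU_one _, fun _ => false, ?_⟩
  rw [hVg, Matrix.one_mulVec, Matrix.one_mulVec]
  rfl

/-- ANY PROOF MUST USE that `U₂` is Clifford: the crux with the Clifford hypothesis on `U₂`
dropped (unitarity kept) is false — `U₂` may be a disentangler. [folklore] -/
theorem false_without_clifford₂ :
    ¬ FrameBound (fun _ => IsCliffordU) (fun _ _ => True) (fun _ => IsGaussianU) := by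
  refine not_frameBound_of_disentangler fun n _ K _ _ _ e => ?_
  obtain ⟨V, hV, hVg⟩ := exists_unitary_ghat_to_zero e
  refine ⟨1, V, 1, Submonoid.one_mem _, isCliffordU_one _, hV, trivial, Submonoid.one_mem _,
    isGaussianU_one _, fun _ => false, ?_⟩
  rw [Matrix.one_mulVec, Matrix.one_mulVec, hVg]
  rfl

/-- ANY PROOF MUST USE that `U` is Gaussian: the crux with the Gaussian hypothesis on `U`
dropped (unitarity kept) is false — `U` may be a disentangler. [folklore] -/
theorem false_without_gaussian :
    ¬ FrameBound (fun _ => IsCliffordU) (fun _ => IsCliffordU) (fun _ _ => True) := by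
  refine not_frameBound_of_disentangler fun n _ K _ _ _ e => ?_
  obtain ⟨V, hV, hVg⟩ := exists_unitary_ghat_to_zero e
  refine ⟨1, 1, V, Submonoid.one_mem _, isCliffordU_one _, Submonoid.one_mem _, isCliffordU_one _,
    hV, trivial, fun _ => false, ?_⟩
  rw [Matrix.one_mulVec, Matrix.one_mulVec, hVg]
  rfl


end Summit.QuantumAdvantage.QuantumAdvantage.Theorems.CompositeFrameBound.Negative
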